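import Summits.ResolutionOfSingularities.ResolutionOfSingularities.Theses.Valuative
import Literature.AlgebraicGeometry.Resolution.LocalUniformization
import Literature.AlgebraicGeometry.Resolution.FieldsJ2

/-!
# Route `Valuative`, item `RankOneRelOfNS2014` (stmt-ResolutionOfSingularities-0738)

Rank-one reduction of RELATIVE Zariski local uniformization in characteristic `p`, discharged
from the named fact `Literature.AlgebraicGeometry.Resolution.NovacoskiSpivakovsky2014`
(Novacoski–Spivakovsky, arXiv:1204.4751, Thm. 1.1; proved in tree as
`NovacoskiSpivakovsky2014_holds`), which is received as the antecedent of the item.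

The item differs from the fact only by bookkeeping, and this file is the translation glue:
1. the item's conclusion quantifies over ALL finitely generated `R ⊆ O` (not only affine models,
   `Frac R = K`): enlarge `R` to `R ⊔ A` for an affine model `A ⊆ O` of `K/k`
   (`exists_affineModel`), which is again finitely generated, lies in `O`, and has fraction
   field `K` (`exists_fg_isFractionRing_ge`);
2. the fact's hypothesis asks for `RelLocalUniformization k K' O'` for EVERY field `K' ⊇ k` and
   every rank-one `O'`, while the item's hypothesis only covers finitely generated `K'/k` with
   `k ⊆ O'`: but `RelLocalUniformization k K' O'` only speaks about finitely generated
   `R ⊆ O'` with `Frac R = K'`, and the existence of one such `R` forces `K'/k` finitely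
   generated (`IntermediateField.fg_top_of_isFractionRing_of_finiteType`) and `k ⊆ R ⊆ O'`
   (`relLocalUniformization_of_rankOne_hypothesis`);
3. `Frac A = K` for the output model from `R ⊔ A' ≤ A` (`isFractionRing_subalgebra_of_le`).
-/

noncomputable section

open Literature.AlgebraicGeometry.Resolution

-- `Summit.<Summit>.<Sub>.Theorems` with `Sub = Summit` (single-conjunct summit, D-0017): the
-- duplicated namespace component is the tree layout.
set_option linter.dupNamespace false

namespace Summit.ResolutionOfSingularities.ResolutionOfSingularities.Theorems

/-- **Enlarging a finitely generated subring of `O` to an affine model.** If `K/k` is finitely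
generated and `k ⊆ O`, every finitely generated `k`-subalgebra `R ⊆ O` is contained in a
finitely generated `k`-subalgebra `R' ⊆ O` with `Frac R' = K` (take `R' = R ⊔ A` for an affine
model `A ⊆ O`, `exists_affineModel`: adjoin `x` or `x⁻¹`, whichever lies in `O`, for each field
generator `x`). [folklore] -/
theorem exists_fg_isFractionRing_ge {k K : Type} [Field k] [Field K] [Algebra k K]
    (hfg : (⊤ : IntermediateField k K).FG) (O : ValuationSubring K)
    (hO : ∀ c : k, algebraMap k K c ∈ O) (R : Subalgebra k K) (hR : R.FG)
    (hRO : R.toSubring ≤ O.toSubring) :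
    ∃ R' : Subalgebra k K, R ≤ R' ∧ R'.FG ∧ R'.toSubring ≤ O.toSubring ∧ IsFractionRing R' K := by
  obtain ⟨A, hAO, hAfg, hAfrac⟩ := exists_affineModel k K hfg O hO
  refine ⟨R ⊔ A, le_sup_left, hR.sup hAfg, ?_, ?_⟩
  · -- `O` as a `k`-subalgebra, so that `R ⊔ A ≤ O` is a statement in the subalgebra lattice
    let Oalg : Subalgebra k K := { O.toSubring with algebraMap_mem' := hO }
    have h : R ⊔ A ≤ Oalg := sup_le (fun x hx => hRO hx) (fun x hx => hAO hx)
    exact fun x hx => h hx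
  · haveI := hAfrac
    exact isFractionRing_subalgebra_of_le A (R ⊔ A) le_sup_right

/-- **The fact's rank-one hypothesis from the item's.** Relative local uniformization of the
rank-one valuation rings of the finitely generated extensions `K'/k` with `k ⊆ O'` (in the
item's form, with the extra conclusion `Frac A = K'`) already gives
`RelLocalUniformization k K' O'` for EVERY field `K' ⊇ k` and every rank-one `O'`: the latter
only concerns finitely generated `R ⊆ O'` with `Frac R = K'`, and one such `R` makes `K'/k`
finitely generated (`IntermediateField.fg_top_of_isFractionRing_of_finiteType`) and gives
`k ⊆ R ⊆ O'`. [folklore] -/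
theorem relLocalUniformization_of_rankOne_hypothesis {p : ℕ}
    (h1 : ∀ (k K : Type) [Field k] [CharP k p] [Field K] [Algebra k K],
      (⊤ : IntermediateField k K).FG → ∀ O : ValuationSubring K, (∀ c : k, algebraMap k K c ∈ O) →
      Nonempty O.valuation.RankOne → ∀ R : Subalgebra k K, R.FG → R.toSubring ≤ O.toSubring →
      ∃ (A : Subalgebra k K) (h : A.toSubring ≤ O.toSubring), R ≤ A ∧ A.FG ∧ IsFractionRing A K ∧
        IsRegularLocalRing
          (Localization.AtPrime (Ideal.comap (Subring.inclusion h) (IsLocalRing.maximalIdeal O))))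
    (k : Type) [Field k] [CharP k p] (K : Type) [Field K] [Algebra k K] (O : ValuationSubring K)
    (hO : Nonempty O.valuation.RankOne) : RelLocalUniformization k K O := by
  intro R hR hfrac hRO
  have hkO : ∀ c : k, algebraMap k K c ∈ O := fun c => hRO (R.algebraMap_mem c)
  have hfg : (⊤ : IntermediateField k K).FG := by
    haveI : Algebra.FiniteType k R := R.fg_iff_finiteType.mp hR
    haveI := hfrac
    exact IntermediateField.fg_top_of_isFractionRing_of_finiteType k R K
  obtain ⟨A, hA, hRA, hAfg, -, hreg⟩ := h1 k K hfg O hkO hO R hR hRO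
  exact ⟨A, hA, hRA, hAfg, hreg⟩

/-- **Item `RankOneRelOfNS2014` (stmt-ResolutionOfSingularities-0738), PROVED.** Given the
named fact `NovacoskiSpivakovsky2014` (Novacoski–Spivakovsky 2014, Thm. 1.1, for local domains
essentially of finite type over `k`; in tree: `NovacoskiSpivakovsky2014_holds`): for every
prime `p`, if RELATIVE local uniformization holds along every RANK-ONE valuation ring `O ⊇ k`
of every finitely generated `K/k` with `char k = p`, then it holds along every valuation ring.
Proof: enlarge the given finitely generated `R ⊆ O` to an affine model `R' ⊇ R` inside `O`
(`exists_fg_isFractionRing_ge`), apply the fact to `R'` — its rank-one hypothesis being the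
item's (`relLocalUniformization_of_rankOne_hypothesis`) — and read off `Frac A = K` from
`R' ≤ A` (`isFractionRing_subalgebra_of_le`). [cite: NovacoskiSpivakovsky2014, Thm. 1.1] -/
theorem rankOneRelOfNS2014_proof :
    Summit.ResolutionOfSingularities.ResolutionOfSingularities.Theses.Valuative.RankOneRelOfNS2014 := by
  unfold Theses.Valuative.RankOneRelOfNS2014
  intro hNS p _hp h1 k K _ _ _ _ hfg O hO R hR hRO
  obtain ⟨R', hRR', hR'fg, hR'O, hR'frac⟩ := exists_fg_isFractionRing_ge hfg O hO R hR hRO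
  obtain ⟨A, hA, hR'A, hAfg, hreg⟩ :=
    hNS k (relLocalUniformization_of_rankOne_hypothesis h1 k) K O R' hR'fg hR'frac hR'O
  haveI := hR'frac
  exact ⟨A, hA, hRR'.trans hR'A, hAfg, isFractionRing_subalgebra_of_le R' A hR'A, hreg⟩

end Summit.ResolutionOfSingularities.ResolutionOfSingularities.Theorems

end
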